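import Literature.RingTheory.GaloisAlgebras.ChaseHarrisonRosenbergTorsor
import Mathlib.RingTheory.Etale.Descent
import Mathlib.RingTheory.Etale.Pi
import Mathlib.RingTheory.Flat.FaithfullyFlat.Algebra
import HarnessLib

/-!
# Galois extensions of commutative rings are finite étale

Continuation of `ChaseHarrisonRosenberg` / `ChaseHarrisonRosenbergTorsor`: for a free action of a
finite group `G` on a commutative ring `B` with ring of invariants `A = B^G` (a `G`-Galois
extension `B ⊇ A`, Greither LNM 1534, Ch. 0, Def. 1.5 / Thm. 1.6 = Chase–Harrison–Rosenberg 1965,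
Thm. 1.3), the structure map `A → B` is **faithfully flat** (`faithfullyFlat_of_free`: flat by
Thm. 1.6 (iii), and `Spec B → Spec A` is surjective since `B` is integral over `A = B^G`) and
**étale** (`etale_of_free`): the torsor isomorphism `B ⊗_A B ≅ ∏_G B` (Thm. 1.6 (i),
`canonicalEquiv`) is `B`-linear for the left factor (made explicit inside the proof), `∏_G B` is
étale over `B`, and étaleness descends along the faithfully flat `A → B` (Mathlib
`Algebra.Etale.of_etale_tensorProduct_of_faithfullyFlat`). Geometrically: the quotient map of a
free action of a finite group is a finite étale (`G`-torsor) cover (SGA 1, Exp. V, Prop. 2.6 /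
Cor. 2.4; Greither, Ch. 0, §1).

Everything is proved; no named facts.

## References

* [Greither1992CyclicGalois] C. Greither, *Cyclic Galois Extensions of Commutative Rings*, LNM
  1534 (1992), Ch. 0, Def. 1.5, Thm. 1.6, Lemma 1.9 (pp. 2–5).
* [SGA1] A. Grothendieck, *SGA 1*, Exp. V, §2 (Cor. 2.4, Prop. 2.6).
-/

noncomputable section

open scoped TensorProduct

namespace Literature.RingTheory.GaloisAlgebras

variable (A : Type*) {B : Type*} [CommRing A] [CommRing B] [Algebra A B]
variable (G : Type*) [Group G] [MulSemiringAction G B] [SMulCommClass G A B]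
variable [Fintype G] [Algebra.IsInvariant A B G] [FaithfulSMul A B]

/-- **A Galois extension is faithfully flat**: for a free action with `B^G = A ⊆ B`, `B` is a
faithfully flat `A`-module — flat (`flat_of_free`) and `Spec B → Spec A` surjective, `B` being
integral over its invariants (Mathlib `Algebra.IsInvariant.isIntegral`,
`Algebra.IsIntegral.comap_surjective`). [cite: Greither1992CyclicGalois, Ch. 0 Thm. 1.6 (iii) and Lemma 1.9 (pp. 3–5)] -/
theorem faithfullyFlat_of_free
    (hfree : ∀ g : G, g ≠ 1 → Ideal.span (Set.range fun b : B ↦ g • b - b) = ⊤) :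
    Module.FaithfullyFlat A B := by
  haveI := flat_of_free A G (B := B) hfree
  haveI : Algebra.IsIntegral A B := Algebra.IsInvariant.isIntegral A B G
  exact Module.FaithfullyFlat.of_comap_surjective (Algebra.IsIntegral.comap_surjective A B)

/-- **A Galois extension of commutative rings is étale** (SGA 1, V, Prop. 2.6: the quotient by a
free action of a finite group is an étale cover; Greither, Ch. 0, §1): after the faithfully flat
base change `A → B` the algebra `B` becomes `B ⊗_A B ≅ ∏_G B`, which is étale over `B`, and
étaleness descends along faithfully flat maps (Mathlib
`Algebra.Etale.of_etale_tensorProduct_of_faithfullyFlat`). [cite: SGA1, Exp. V, Prop. 2.6]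
[cite: Greither1992CyclicGalois, Ch. 0 Thm. 1.6 (pp. 3–4)] -/
theorem etale_of_free
    (hfree : ∀ g : G, g ≠ 1 → Ideal.span (Set.range fun b : B ↦ g • b - b) = ⊤) :
    Algebra.Etale A B := by
  haveI := faithfullyFlat_of_free A G (B := B) hfree
  -- the torsor isomorphism `B ⊗_A B ≃ (G → B)`, `x ⊗ y ↦ (x · g(y))_g`, is `B`-linear for the
  -- `B`-algebra structure on the LEFT factor and the diagonal one on `G → B`
  let e : B ⊗[A] B ≃ₐ[B] (G → B) :=
    AlgEquiv.ofRingEquiv (f := (canonicalEquiv A G hfree).toRingEquiv) fun x ↦ by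
      change canonicalEquiv A G hfree (algebraMap B (B ⊗[A] B) x) = algebraMap B (G → B) x
      rw [canonicalEquiv_apply, Algebra.TensorProduct.algebraMap_apply, Algebra.algebraMap_self,
        RingHom.id_apply]
      funext g
      rw [canonicalMap_tmul, smul_one, mul_one]
      rfl
  haveI : Algebra.Etale B (B ⊗[A] B) := Algebra.Etale.of_equiv e.symm
  exact Algebra.Etale.of_etale_tensorProduct_of_faithfullyFlat B

/-- A Galois extension of commutative rings is finite étale: `B` is a finite `A`-module
(`finite_of_free`) and `A → B` is étale (`etale_of_free`). [cite: Greither1992CyclicGalois, Ch. 0 Thm. 1.6 (pp. 3–4)] -/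
theorem finite_and_etale_of_free
    (hfree : ∀ g : G, g ≠ 1 → Ideal.span (Set.range fun b : B ↦ g • b - b) = ⊤) :
    Module.Finite A B ∧ Algebra.Etale A B :=
  ⟨finite_of_free A G hfree, etale_of_free A G hfree⟩

end Literature.RingTheory.GaloisAlgebras

end
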